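import Literature.NumberTheory.Automorphic.UnitaryGroupTorusOrbitalIntegralCanonicalFrame   -- ★ P-3 FILE D p846476: `classOrbitalIntegral_eq_smul_integral_prod_of_torus_regular_of_frame`
import Literature.NumberTheory.Automorphic.HeisenbergStrataIntegral                          -- ★ P-3 FILE C p846460: `integral_eq_of_eq_piece_rank` (+ ★ FILE A `redMat_map_heisElt_sub_one_pow_three`)
import Literature.NumberTheory.Automorphic.UnitaryDepthZeroPieceOrbitalIntegral              -- ★ A-p12 O8b §1: `rank_redMat_conj_sub_one_eq`, `redMat_conj_sub_one_pow_eq_zero_iff`, `redMat_coe_mul_of_mem_glInt`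
import HarnessLib

/-!
# The canonical orbital integral of a `K`-CLASS PIECE at a deep split-torus class: Ad-`K₃` collapse, class-function descent, the residual-rank instance
(Rogawski (1990) §4.9 pp. 54–56, Prop. 4.9.1; Flicker (1998) §2)

Topic `NumberTheory/Automorphic`; namespace `Literature.NumberTheory.Automorphic.UnitaryGroup`.  KERNEL mathematics only: theorems, no definition, no named fact,
no instance, no notation, no `sorry`.  Cell `pub/hodgecm-mathlib`, road «S3-tree», T3′ «DEPTH-ZERO κ-TRANSFER» population P-3 «LEVI», organ **(O2)-GEN «TORUS-DEEP
STRATA DESCENT FOR A GENERAL `K`-CLASS PIECE»** (architect A-114 ∕ A-116; seat F0P3a-p04 (g17)); sequel of ★ FILE D `UnitaryGroupTorusOrbitalIntegralCanonicalFrame` and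
★ FILE C `HeisenbergStrataIntegral`.  CONSUMERS BY NAME: L-γ `stub_T3prime_levi` (F0P3a-p01: (O2) := §3) and `stub_liftLevi` (F0P3-p02 + F0P3a-p01: §1–§2 with the five
level-2 strata).  HONEST LABEL: HC_CM is proved only modulo the 2 remaining named inputs (hLiu418, h413) until rung 0 closes; this file discharges no named fact.

THE MATHEMATICS.  `L` CM, `v` a finite place of `L⁺` NON-SPLIT in `L` (`w ∣ v`, `c • w = w`), `G′_v = U(H)(L⁺_v)` an inner form with hyperspecial level `K′ = U(H)(𝒪_v)`,
`G₃ = U(Φ₃)(L⁺_v) ⊃ K₃ = U(Φ₃)(𝒪_v) ⊃ B = TN` the Borel pair of the split form, `ψ : G′_v ≃ G₃` a continuous multiplicative equivalence with `ψ(K′) = K₃` whose values are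
`GL₃(∏ L_w)`-conjugate to their arguments (the Jacobowitz frame ★ `exists_continuousMulEquiv_level_formCongr_of_nonsplit`, which moreover reads `(ψ g)_w = T g_w T⁻¹`,
`T ∈ GL₃(𝒪_w)`), `g : G′_v → ℂ` a `K′`-CLASS PIECE (`Ad K′`-invariant; for §3 also supported in `K′` and constant `= c r` on the residually-unipotent Jordan stratum
`rank(red k_w − 1) = r` of `K′` — the `hgK`∕`hginv`∕`hc` binders of HEAD v4's depth-zero pieces), `t = diag(d) ∈ T` REGULAR, `γ₀ = ψ⁻¹(t)`.
* §1 **Ad-`K` COLLAPSE** (pure group theory + Fubini): `∫_{K × N} g(e(k (x n) k⁻¹)) d(κ ⊗ μ_N) = κ(K) · ∫_N g(e(x n)) dμ_N` for any hom `e` with `e(K) ⊆ K′`.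
* §2 **CLASS-FUNCTION DESCENT**: ★ FILE D (`Ψ := ψ`, `K := K₃`, `κ := haar`) + §1:
  `Φ(⟦γ₀⟧, g) = ν_G(K′) · J₃(t) · μ_N(N ∩ K₃)⁻¹ · ∫_N F dμ_N` whenever `g(ψ⁻¹(t n)) = F(n)` on `N`; SOCKET form: `∫_N F = μ_N(N ∩ K₃) · X ⟹ Φ(⟦γ₀⟧, g) = ν_G(K′) · J₃(t) · X`.
* §3 **THE RESIDUAL-RANK INSTANCE** (`t` DEEP: `dᵢ ≡ 1 (mod 𝔪_w)`): `t ∈ K₃`, `red(t_w) = 1`, and `g(ψ⁻¹(t n)) = [n ∈ K₃] · c(rank(red(n_w) − 1))` (`(ψ⁻¹(tn))_w = T⁻¹ t_w n_w T`,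
  `red(t_w n_w) = red(n_w)` ★ L-α1, rank∕nilpotency `GL₃(𝒪_w)`-conjugation invariant ★ O8b §1, `(red(n_w) − 1)³ = 0` ★ FILE A); with ★ FILE C:
  **`Φ(⟦γ₀⟧, g) = ν_G(K′) · J₃(t) · q⁻³ · (c₀·1 + c₁·(q − 1) + c₂·(q³ − q))`** (`v ∤ 2`, `v` unramified).

## References
* [Rogawski1990] J. D. Rogawski, *Automorphic Representations of Unitary Groups in Three Variables*, Ann. of Math. Stud. 123 (1990), §4.9 pp. 54–56 (Prop. 4.9.1), §4.3 (4.3.1) p. 43.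
* [Flicker1998UnitaryFL] Y. Z. Flicker, *Elementary proof of the fundamental lemma for a unitary group*, Canad. J. Math. 50 (1998), §2.
* [Kottwitz1986] R. E. Kottwitz, *Base change for unit elements of Hecke algebras*, Compositio Math. 60 (1986), §3.
* [DeitmarEchterhoff2014] A. Deitmar, S. Echterhoff, *Principles of Harmonic Analysis*, 2nd ed. (2014), Thm. 1.5.3.
-/

set_option autoImplicit false

noncomputable section

open MeasureTheory Measure Set Filter Topology NumberField IsDedekindDomain
open Literature.MeasureTheory.Group
open scoped ENNReal NNReal Matrix MatrixGroups ValuativeRel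

namespace Literature.NumberTheory.Automorphic.UnitaryGroup

open Literature.NumberTheory.Rogawski1990 (IsRegularElt)
open Literature.NumberTheory.Automorphic Literature.NumberTheory.Automorphic.IntegralReduction

/-! ## §1 Ad-`K` collapse of the Iwasawa integrand for a `K′`-class function -/

/-- **Ad-`K` COLLAPSE.**  `G, G′` groups, `e : G → G′` a multiplicative map (e.g. `ψ⁻¹` for a frame `ψ : G′ ≃ G`), `K ≤ G`, `K′ ≤ G′` with `e(K) ⊆ K′`, `N ≤ G`, `κ`, `μ_N`
s-finite measures on `K`, `N`, `g : G′ → E` invariant under `Ad K′`.  Then for every `x ∈ G` and every `F` with `g(e(x n)) = F(n)` on `N`: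
**`∫_{K × N} g(e(k · (x n) · k⁻¹)) d(κ ⊗ μ_N) = κ(K) • ∫_N F dμ_N`** (`e(k y k⁻¹) = e(k) e(y) e(k)⁻¹`, `hginv`, then Fubini for a function of the second variable,
Mathlib `integral_fun_snd`). [cite: Rogawski1990, §4.9 p. 54] [cite: DeitmarEchterhoff2014, Thm. 1.5.3] -/
theorem integral_prod_conj_eq_smul_integral_of_conj_invariant {G G' : Type*} [Group G] [Group G'] {Φ : Type*} [FunLike Φ G G'] [MonoidHomClass Φ G G'] (e : Φ)
    {K : Subgroup G} {K' : Subgroup G'} (heK : ∀ k ∈ K, e k ∈ K') {N : Subgroup G}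
    [MeasurableSpace ↥K] (κ : Measure ↥K) [SFinite κ] [MeasurableSpace ↥N] (μN : Measure ↥N) [SFinite μN]
    {E : Type*} [NormedAddCommGroup E] [NormedSpace ℝ E] (g : G' → E) (hginv : ∀ u ∈ K', ∀ y, g (u * y * u⁻¹) = g y)
    (x : G) (F : ↥N → E) (hF : ∀ n : ↥N, g (e (x * (n : G))) = F n) :
    ∫ p : ↥K × ↥N, g (e ((p.1 : G) * (x * (p.2 : G)) * (p.1 : G)⁻¹)) ∂(κ.prod μN) = κ.real univ • ∫ n, F n ∂μN := by
  have hpt : ∀ p : ↥K × ↥N, g (e ((p.1 : G) * (x * (p.2 : G)) * (p.1 : G)⁻¹)) = F p.2 := by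
    intro p
    rw [map_mul, map_mul, map_inv, hginv _ (heK _ p.1.2), hF]
  simp_rw [hpt]
  exact integral_fun_snd F

/-! ## §2 The class-function descent through a level-preserving frame -/

/-- Scalar bookkeeping for §2: `((A∕(BC))·J)·(B·I) = A·J·(C⁻¹·I)` for `B, C ∈ (0, ∞)`. [folklore] -/
private theorem toReal_div_mul_mul_aux {A B C : ℝ≥0∞} (J : ℝ≥0) (hB0 : B ≠ 0) (hB : B ≠ ∞) (hC0 : C ≠ 0) (hC : C ≠ ∞) (I : ℂ) :
    (((A / (B * C) * (J : ℝ≥0∞)).toReal : ℝ) : ℂ) * (((B.toReal : ℝ) : ℂ) * I) =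
      ((A.toReal : ℝ) : ℂ) * (((J : ℝ≥0) : ℝ) : ℂ) * ((((C.toReal : ℝ) : ℂ))⁻¹ * I) := by
  have hb : (B.toReal : ℂ) ≠ 0 := Complex.ofReal_ne_zero.2 (ENNReal.toReal_ne_zero.2 ⟨hB0, hB⟩)
  have hc : (C.toReal : ℂ) ≠ 0 := Complex.ofReal_ne_zero.2 (ENNReal.toReal_ne_zero.2 ⟨hC0, hC⟩)
  rw [ENNReal.toReal_mul, ENNReal.toReal_div, ENNReal.toReal_mul, ENNReal.coe_toReal]
  push_cast
  field_simp


/-- **`0 < μ_N(N ∩ K₃)`** (and `< ∞`) for every Haar measure `μ_N` of `N = N(Φ₃)(L⁺_v)`: `N ∩ K₃` is open in `N` (it contains `1`; `K₃` is open in `G₃`) and compact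
(`K₃` compact, `N` closed) — the normalisation the socket form divides by. [cite: Rogawski1990, §4.9 p. 54; §4.3 (4.3.1) p. 43] -/
theorem measureReal_unipotent_level_pos (L : Type) [Field L] [NumberField L] [IsCMField L] (v : HeightOneSpectrum (𝓞 ↥(maximalRealSubfield L)))
    [MeasurableSpace ↥(unitaryGroupOfForm (conjLocal L (IsCMField.complexConj L) v) (cmLocalForm L 3 v))]
    [BorelSpace ↥(unitaryGroupOfForm (conjLocal L (IsCMField.complexConj L) v) (cmLocalForm L 3 v))]
    (μN : Measure ↥(unipotentU (conjLocal L (IsCMField.complexConj L) v) (cmLocalForm L 3 v))) [μN.IsHaarMeasure] :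
    0 < μN.real {n : ↥(unipotentU (conjLocal L (IsCMField.complexConj L) v) (cmLocalForm L 3 v)) |
        (n : ↥(unitaryGroupOfForm (conjLocal L (IsCMField.complexConj L) v) (cmLocalForm L 3 v))) ∈
          cmLocalIntegralLevel L 3 (Matrix.of fun i j : Fin 3 => if i.val + j.val + 1 = 3 then (1 : L) else 0) v} := by
  have hK3co := isCompact_isOpen_cmLocalIntegralLevel L 3 (Matrix.of fun i j : Fin 3 => if i.val + j.val + 1 = 3 then (1 : L) else 0) v
  have hSo : IsOpen {n : ↥(unipotentU (conjLocal L (IsCMField.complexConj L) v) (cmLocalForm L 3 v)) |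
      (n : ↥(unitaryGroupOfForm (conjLocal L (IsCMField.complexConj L) v) (cmLocalForm L 3 v))) ∈
        cmLocalIntegralLevel L 3 (Matrix.of fun i j : Fin 3 => if i.val + j.val + 1 = 3 then (1 : L) else 0) v} :=
    hK3co.2.preimage continuous_subtype_val
  have hSc : IsCompact {n : ↥(unipotentU (conjLocal L (IsCMField.complexConj L) v) (cmLocalForm L 3 v)) |
      (n : ↥(unitaryGroupOfForm (conjLocal L (IsCMField.complexConj L) v) (cmLocalForm L 3 v))) ∈
        cmLocalIntegralLevel L 3 (Matrix.of fun i j : Fin 3 => if i.val + j.val + 1 = 3 then (1 : L) else 0) v} :=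
    (isClosed_cmBorelTriple_N L v).isClosedEmbedding_subtypeVal.isCompact_preimage hK3co.1
  exact ENNReal.toReal_pos (hSo.measure_ne_zero μN
    ⟨1, (cmLocalIntegralLevel L 3 (Matrix.of fun i j : Fin 3 => if i.val + j.val + 1 = 3 then (1 : L) else 0) v).one_mem⟩) hSc.measure_lt_top.ne

set_option maxHeartbeats 1600000 in
-- instance-term unification on the CM local carriers (as in ★ FILE D)
/-- **CLASS-FUNCTION DESCENT THROUGH A LEVEL-PRESERVING FRAME.**  Setting of ★ FILE D at the hyperspecial level `K₃ = U(Φ₃)(𝒪_v)` itself, with a frame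
`ψ : U(H)(L⁺_v) ≃ₜ* U(Φ₃)(L⁺_v)` that PRESERVES THE LEVEL (`ψ g ∈ K₃ ↔ g ∈ K′ = U(H)(𝒪_v)`, `hψK`) and induces `GL₃(∏ L_w)`-conjugacy (`hψc`); `m_G` canonical for
`(IsRegularElt, ν_G)`, `t = diag(d) ∈ T` regular (`hreg`, `ha′`, `hb′`), `ψ γ₀ = t`, `μ_N` ANY Haar measure of `N`, and `g` Borel and `Ad K′`-INVARIANT with
`g(ψ⁻¹(t n)) = F(n)` on `N`.  Then
**`classOrbitalIntegral m_G g ⟦γ₀⟧ = ν_G(K′) · J₃(t) · (μ_N(N ∩ K₃)⁻¹ · ∫_N F dμ_N)`**, `J₃(t) = χ(d₀⁻¹d₁ − 1)⁻¹ · χ⁻(d₀⁻¹d₂ − 1)⁻¹` the ★ FILE D token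
(★ FILE D with `κ := haar_{K₃}`; `ψ⁻¹(K₃) = K′`; §1; `κ(K₃)`, `μ_N(N ∩ K₃)` finite and non-zero). [cite: Rogawski1990, §4.9 pp. 54–56; §4.3 (4.3.1) p. 43]
[cite: DeitmarEchterhoff2014, Thm. 1.5.3] -/
theorem classOrbitalIntegral_eq_mul_integral_of_level_frame
    (L : Type) [Field L] [NumberField L] [IsCMField L] (H : Matrix (Fin 3) (Fin 3) L)
    (hH : (H.map (IsCMField.complexConj L))ᵀ = H) (hHd : IsUnit H.det)
    {v : HeightOneSpectrum (𝓞 ↥(maximalRealSubfield L))} (w : PlacesOver L v) (hw : IsCMField.complexConj L • w.1 = w.1)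
    [MeasurableSpace ((cmDatum L 3 H).Local v)] [BorelSpace ((cmDatum L 3 H).Local v)]
    [∀ γ : (cmDatum L 3 H).Local v, MeasurableSpace (((cmDatum L 3 H).Local v) ⧸ Subgroup.centralizer ({γ} : Set ((cmDatum L 3 H).Local v)))]
    [∀ γ : (cmDatum L 3 H).Local v, BorelSpace (((cmDatum L 3 H).Local v) ⧸ Subgroup.centralizer ({γ} : Set ((cmDatum L 3 H).Local v)))]
    (νG : Measure ((cmDatum L 3 H).Local v)) [νG.IsHaarMeasure] [νG.IsMulRightInvariant]
    {mG : OrbitalMeasureFamily ((cmDatum L 3 H).Local v)}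
    (hmG : mG.IsCanonical (fun γ => IsRegularElt (γ.val : GL (Fin 3) (LocalRing L v))) νG)
    [MeasurableSpace ↥(unitaryGroupOfForm (conjLocal L (IsCMField.complexConj L) v) (cmLocalForm L 3 v))]
    [BorelSpace ↥(unitaryGroupOfForm (conjLocal L (IsCMField.complexConj L) v) (cmLocalForm L 3 v))]
    (ψ : (cmDatum L 3 H).Local v ≃ₜ* ↥(unitaryGroupOfForm (conjLocal L (IsCMField.complexConj L) v) (cmLocalForm L 3 v)))
    (hψK : ∀ g : (cmDatum L 3 H).Local v, ψ g ∈ cmLocalIntegralLevel L 3 (Matrix.of fun i j : Fin 3 => if i.val + j.val + 1 = 3 then (1 : L) else 0) v ↔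
      g ∈ cmLocalIntegralLevel L 3 H v)
    (hψc : ∀ g : (cmDatum L 3 H).Local v, IsConj (g.val : GL (Fin 3) (LocalRing L v))
      ((ψ g : ↥(unitaryGroupOfForm (conjLocal L (IsCMField.complexConj L) v) (cmLocalForm L 3 v))) : GL (Fin 3) (LocalRing L v)))
    (μN : Measure ↥(unipotentU (conjLocal L (IsCMField.complexConj L) v) (cmLocalForm L 3 v))) [μN.IsHaarMeasure]
    (t : ↥(torusU (conjLocal L (IsCMField.complexConj L) v) (cmLocalForm L 3 v))) {d : Fin 3 → (LocalRing L v)ˣ}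
    (hd : glDiagonal 3 (LocalRing L v) d =
      ((t : ↥(unitaryGroupOfForm (conjLocal L (IsCMField.complexConj L) v) (cmLocalForm L 3 v))) : GL (Fin 3) (LocalRing L v)))
    (hreg : ∀ i j, i ≠ j → IsUnit ((d i : LocalRing L v) - d j))
    (ha' : IsUnit ((((d 0)⁻¹ * d 1 : (LocalRing L v)ˣ) : LocalRing L v) - 1))
    (hb' : IsUnit ((((d 0)⁻¹ * d 2 : (LocalRing L v)ˣ) : LocalRing L v) - 1))
    {γ₀ : (cmDatum L 3 H).Local v} (hγ₀ : ψ γ₀ = (t : ↥(unitaryGroupOfForm (conjLocal L (IsCMField.complexConj L) v) (cmLocalForm L 3 v))))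
    (g : (cmDatum L 3 H).Local v → ℂ) (hgm : Measurable g)
    (hginv : ∀ u ∈ cmLocalIntegralLevel L 3 H v, ∀ x, g (u * x * u⁻¹) = g x)
    (F : ↥(unipotentU (conjLocal L (IsCMField.complexConj L) v) (cmLocalForm L 3 v)) → ℂ)
    (hF : ∀ n : ↥(unipotentU (conjLocal L (IsCMField.complexConj L) v) (cmLocalForm L 3 v)),
      g (ψ.symm ((t : ↥(unitaryGroupOfForm (conjLocal L (IsCMField.complexConj L) v) (cmLocalForm L 3 v))) *
        (n : ↥(unitaryGroupOfForm (conjLocal L (IsCMField.complexConj L) v) (cmLocalForm L 3 v))))) = F n) :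
    classOrbitalIntegral mG g (ConjClasses.mk γ₀) =
      (νG.real (cmLocalIntegralLevel L 3 H v : Set ((cmDatum L 3 H).Local v)) : ℂ) *
        (((letI : MeasurableSpace (LocalRing L v) := borel _; haveI : BorelSpace (LocalRing L v) := ⟨rfl⟩
          haveI : SecondCountableTopology (LocalRing L v) := secondCountableTopology_localRing (E := L) v
          ((distribHaarChar (LocalRing L v) ha'.unit)⁻¹ *
            (HeisRing.skewModulus (conjLocal L (IsCMField.complexConj L) v) (continuous_conjLocal L (IsCMField.complexConj L) v) hb'.unit
              (HeisRing.map_unit_torusCentralScalar_sub_one (conjLocal L (IsCMField.complexConj L) v) (cmLocalForm_eq_over L 3 v) t hd hb'))⁻¹ :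
                ℝ≥0)) : ℝ≥0) : ℂ) *
        ((μN.real {n : ↥(unipotentU (conjLocal L (IsCMField.complexConj L) v) (cmLocalForm L 3 v)) |
            (n : ↥(unitaryGroupOfForm (conjLocal L (IsCMField.complexConj L) v) (cmLocalForm L 3 v))) ∈
              cmLocalIntegralLevel L 3 (Matrix.of fun i j : Fin 3 => if i.val + j.val + 1 = 3 then (1 : L) else 0) v} : ℂ)⁻¹ *
          ∫ n, F n ∂μN) := by
  -- structure on `G₃ = U(Φ₃)(L⁺_v)`, the level `K := K₃` as a subgroup of `G₃`, its Haar probability-type measure `κ`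
  haveI : LocallyCompactSpace ↥(unitaryGroupOfForm (conjLocal L (IsCMField.complexConj L) v) (cmLocalForm L 3 v)) :=
    locallyCompactSpace_local (IsCMField.complexConj L) 3 _ v
  haveI : SecondCountableTopology ↥(unitaryGroupOfForm (conjLocal L (IsCMField.complexConj L) v) (cmLocalForm L 3 v)) :=
    secondCountableTopology_local (IsCMField.complexConj L) 3 _ v
  obtain ⟨K, hK⟩ : ∃ K : Subgroup ↥(unitaryGroupOfForm (conjLocal L (IsCMField.complexConj L) v) (cmLocalForm L 3 v)),
      ∀ g : ↥(unitaryGroupOfForm (conjLocal L (IsCMField.complexConj L) v) (cmLocalForm L 3 v)),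
        g ∈ K ↔ g ∈ cmLocalIntegralLevel L 3 (Matrix.of fun i j : Fin 3 => if i.val + j.val + 1 = 3 then (1 : L) else 0) v :=
    ⟨cmLocalIntegralLevel L 3 (Matrix.of fun i j : Fin 3 => if i.val + j.val + 1 = 3 then (1 : L) else 0) v, fun _ => Iff.rfl⟩
  have hK3 : K = cmLocalIntegralLevel L 3 (Matrix.of fun i j : Fin 3 => if i.val + j.val + 1 = 3 then (1 : L) else 0) v := Subgroup.ext hK
  have hK3co : IsCompact (K : Set ↥(unitaryGroupOfForm (conjLocal L (IsCMField.complexConj L) v) (cmLocalForm L 3 v))) ∧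
      IsOpen (K : Set ↥(unitaryGroupOfForm (conjLocal L (IsCMField.complexConj L) v) (cmLocalForm L 3 v))) := by
    rw [hK3]; exact isCompact_isOpen_cmLocalIntegralLevel L 3 (Matrix.of fun i j : Fin 3 => if i.val + j.val + 1 = 3 then (1 : L) else 0) v
  haveI : LocallyCompactSpace ↥K := hK3co.1.isClosed.isClosedEmbedding_subtypeVal.locallyCompactSpace
  haveI : CompactSpace ↥K := isCompact_iff_compactSpace.1 hK3co.1
  haveI : LocallyCompactSpace ↥(unipotentU (conjLocal L (IsCMField.complexConj L) v) (cmLocalForm L 3 v)) :=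
    (isClosed_cmBorelTriple_N L v).isClosedEmbedding_subtypeVal.locallyCompactSpace
  haveI : SecondCountableTopology ↥(unipotentU (conjLocal L (IsCMField.complexConj L) v) (cmLocalForm L 3 v)) :=
    TopologicalSpace.Subtype.secondCountableTopology _
  obtain ⟨κ, hκ⟩ : ∃ κ : Measure ↥K, κ.IsHaarMeasure := ⟨Measure.haar, inferInstance⟩
  haveI := hκ
  -- ★ FILE D
  have key := classOrbitalIntegral_eq_smul_integral_prod_of_torus_regular_of_frame L H hH hHd w hw νG hmG ψ hψc hK κ μN t hd hreg ha' hb'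
    hγ₀ hgm
  -- §1: the Ad-`K` collapse
  have heK : ∀ k ∈ K, ψ.symm k ∈ cmLocalIntegralLevel L 3 H v := fun k hk =>
    (hψK _).1 (by rw [ContinuousMulEquiv.apply_symm_apply]; exact (hK k).1 hk)
  have hcol := integral_prod_conj_eq_smul_integral_of_conj_invariant ψ.symm heK κ μN g hginv
    (t : ↥(unitaryGroupOfForm (conjLocal L (IsCMField.complexConj L) v) (cmLocalForm L 3 v))) F hF
  -- the sets and their measures
  have hpre : ψ ⁻¹' (K : Set ↥(unitaryGroupOfForm (conjLocal L (IsCMField.complexConj L) v) (cmLocalForm L 3 v))) =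
      (cmLocalIntegralLevel L 3 H v : Set ((cmDatum L 3 H).Local v)) := by
    ext x
    rw [Set.mem_preimage, SetLike.mem_coe, SetLike.mem_coe]
    exact (hK _).trans (hψK x)
  have hS : {n : ↥(unipotentU (conjLocal L (IsCMField.complexConj L) v) (cmLocalForm L 3 v)) |
        (n : ↥(unitaryGroupOfForm (conjLocal L (IsCMField.complexConj L) v) (cmLocalForm L 3 v))) ∈ K} =
      {n : ↥(unipotentU (conjLocal L (IsCMField.complexConj L) v) (cmLocalForm L 3 v)) |
        (n : ↥(unitaryGroupOfForm (conjLocal L (IsCMField.complexConj L) v) (cmLocalForm L 3 v))) ∈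
          cmLocalIntegralLevel L 3 (Matrix.of fun i j : Fin 3 => if i.val + j.val + 1 = 3 then (1 : L) else 0) v} :=
    Set.ext fun n => hK _
  have hB0 : κ univ ≠ 0 := IsOpen.measure_ne_zero κ isOpen_univ univ_nonempty
  have hB : κ univ ≠ ∞ := (isCompact_univ.measure_lt_top (μ := κ)).ne
  have hSo : IsOpen {n : ↥(unipotentU (conjLocal L (IsCMField.complexConj L) v) (cmLocalForm L 3 v)) |
      (n : ↥(unitaryGroupOfForm (conjLocal L (IsCMField.complexConj L) v) (cmLocalForm L 3 v))) ∈ K} :=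
    hK3co.2.preimage continuous_subtype_val
  have hSc : IsCompact {n : ↥(unipotentU (conjLocal L (IsCMField.complexConj L) v) (cmLocalForm L 3 v)) |
      (n : ↥(unitaryGroupOfForm (conjLocal L (IsCMField.complexConj L) v) (cmLocalForm L 3 v))) ∈ K} :=
    (isClosed_cmBorelTriple_N L v).isClosedEmbedding_subtypeVal.isCompact_preimage hK3co.1
  have hC0 : μN {n : ↥(unipotentU (conjLocal L (IsCMField.complexConj L) v) (cmLocalForm L 3 v)) |
      (n : ↥(unitaryGroupOfForm (conjLocal L (IsCMField.complexConj L) v) (cmLocalForm L 3 v))) ∈ K} ≠ 0 :=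
    hSo.measure_ne_zero μN ⟨1, K.one_mem⟩
  have hC : μN {n : ↥(unipotentU (conjLocal L (IsCMField.complexConj L) v) (cmLocalForm L 3 v)) |
      (n : ↥(unitaryGroupOfForm (conjLocal L (IsCMField.complexConj L) v) (cmLocalForm L 3 v))) ∈ K} ≠ ∞ :=
    hSc.measure_lt_top.ne
  rw [key, hcol, Complex.real_smul, Complex.real_smul, hpre, ← hS]
  exact toReal_div_mul_mul_aux _ hB0 hB hC0 hC _

set_option maxHeartbeats 1600000 in
-- instance-term unification on the CM local carriers (as in ★ FILE D)
/-- **CLASS-FUNCTION DESCENT, SOCKET FORM.**  In the setting of `classOrbitalIntegral_eq_mul_integral_of_level_frame`: if the strata evaluation reads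
`∫_N F dμ_N = μ_N(N ∩ K₃) · X` (★ FILE C at level 1; the five level-2 strata of `stub_liftLevi`), then
**`classOrbitalIntegral m_G g ⟦γ₀⟧ = ν_G(K′) · J₃(t) · X`** — the Haar normalisations `κ`, `μ_N` have cancelled. [cite: Rogawski1990, §4.9 pp. 54–56; §4.3 (4.3.1) p. 43]
[cite: DeitmarEchterhoff2014, Thm. 1.5.3] -/
theorem classOrbitalIntegral_eq_mul_of_level_frame_of_integral_eq
    (L : Type) [Field L] [NumberField L] [IsCMField L] (H : Matrix (Fin 3) (Fin 3) L)
    (hH : (H.map (IsCMField.complexConj L))ᵀ = H) (hHd : IsUnit H.det)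
    {v : HeightOneSpectrum (𝓞 ↥(maximalRealSubfield L))} (w : PlacesOver L v) (hw : IsCMField.complexConj L • w.1 = w.1)
    [MeasurableSpace ((cmDatum L 3 H).Local v)] [BorelSpace ((cmDatum L 3 H).Local v)]
    [∀ γ : (cmDatum L 3 H).Local v, MeasurableSpace (((cmDatum L 3 H).Local v) ⧸ Subgroup.centralizer ({γ} : Set ((cmDatum L 3 H).Local v)))]
    [∀ γ : (cmDatum L 3 H).Local v, BorelSpace (((cmDatum L 3 H).Local v) ⧸ Subgroup.centralizer ({γ} : Set ((cmDatum L 3 H).Local v)))]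
    (νG : Measure ((cmDatum L 3 H).Local v)) [νG.IsHaarMeasure] [νG.IsMulRightInvariant]
    {mG : OrbitalMeasureFamily ((cmDatum L 3 H).Local v)}
    (hmG : mG.IsCanonical (fun γ => IsRegularElt (γ.val : GL (Fin 3) (LocalRing L v))) νG)
    [MeasurableSpace ↥(unitaryGroupOfForm (conjLocal L (IsCMField.complexConj L) v) (cmLocalForm L 3 v))]
    [BorelSpace ↥(unitaryGroupOfForm (conjLocal L (IsCMField.complexConj L) v) (cmLocalForm L 3 v))]
    (ψ : (cmDatum L 3 H).Local v ≃ₜ* ↥(unitaryGroupOfForm (conjLocal L (IsCMField.complexConj L) v) (cmLocalForm L 3 v)))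
    (hψK : ∀ g : (cmDatum L 3 H).Local v, ψ g ∈ cmLocalIntegralLevel L 3 (Matrix.of fun i j : Fin 3 => if i.val + j.val + 1 = 3 then (1 : L) else 0) v ↔
      g ∈ cmLocalIntegralLevel L 3 H v)
    (hψc : ∀ g : (cmDatum L 3 H).Local v, IsConj (g.val : GL (Fin 3) (LocalRing L v))
      ((ψ g : ↥(unitaryGroupOfForm (conjLocal L (IsCMField.complexConj L) v) (cmLocalForm L 3 v))) : GL (Fin 3) (LocalRing L v)))
    (μN : Measure ↥(unipotentU (conjLocal L (IsCMField.complexConj L) v) (cmLocalForm L 3 v))) [μN.IsHaarMeasure]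
    (t : ↥(torusU (conjLocal L (IsCMField.complexConj L) v) (cmLocalForm L 3 v))) {d : Fin 3 → (LocalRing L v)ˣ}
    (hd : glDiagonal 3 (LocalRing L v) d =
      ((t : ↥(unitaryGroupOfForm (conjLocal L (IsCMField.complexConj L) v) (cmLocalForm L 3 v))) : GL (Fin 3) (LocalRing L v)))
    (hreg : ∀ i j, i ≠ j → IsUnit ((d i : LocalRing L v) - d j))
    (ha' : IsUnit ((((d 0)⁻¹ * d 1 : (LocalRing L v)ˣ) : LocalRing L v) - 1))
    (hb' : IsUnit ((((d 0)⁻¹ * d 2 : (LocalRing L v)ˣ) : LocalRing L v) - 1))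
    {γ₀ : (cmDatum L 3 H).Local v} (hγ₀ : ψ γ₀ = (t : ↥(unitaryGroupOfForm (conjLocal L (IsCMField.complexConj L) v) (cmLocalForm L 3 v))))
    (g : (cmDatum L 3 H).Local v → ℂ) (hgm : Measurable g)
    (hginv : ∀ u ∈ cmLocalIntegralLevel L 3 H v, ∀ x, g (u * x * u⁻¹) = g x)
    (F : ↥(unipotentU (conjLocal L (IsCMField.complexConj L) v) (cmLocalForm L 3 v)) → ℂ)
    (hF : ∀ n : ↥(unipotentU (conjLocal L (IsCMField.complexConj L) v) (cmLocalForm L 3 v)),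
      g (ψ.symm ((t : ↥(unitaryGroupOfForm (conjLocal L (IsCMField.complexConj L) v) (cmLocalForm L 3 v))) *
        (n : ↥(unitaryGroupOfForm (conjLocal L (IsCMField.complexConj L) v) (cmLocalForm L 3 v))))) = F n)
    (X : ℂ)
    (hX : ∫ n, F n ∂μN =
      (μN.real {n : ↥(unipotentU (conjLocal L (IsCMField.complexConj L) v) (cmLocalForm L 3 v)) |
          (n : ↥(unitaryGroupOfForm (conjLocal L (IsCMField.complexConj L) v) (cmLocalForm L 3 v))) ∈
            cmLocalIntegralLevel L 3 (Matrix.of fun i j : Fin 3 => if i.val + j.val + 1 = 3 then (1 : L) else 0) v} : ℂ) * X) :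
    classOrbitalIntegral mG g (ConjClasses.mk γ₀) =
      (νG.real (cmLocalIntegralLevel L 3 H v : Set ((cmDatum L 3 H).Local v)) : ℂ) *
        (((letI : MeasurableSpace (LocalRing L v) := borel _; haveI : BorelSpace (LocalRing L v) := ⟨rfl⟩
          haveI : SecondCountableTopology (LocalRing L v) := secondCountableTopology_localRing (E := L) v
          ((distribHaarChar (LocalRing L v) ha'.unit)⁻¹ *
            (HeisRing.skewModulus (conjLocal L (IsCMField.complexConj L) v) (continuous_conjLocal L (IsCMField.complexConj L) v) hb'.unit
              (HeisRing.map_unit_torusCentralScalar_sub_one (conjLocal L (IsCMField.complexConj L) v) (cmLocalForm_eq_over L 3 v) t hd hb'))⁻¹ :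
                ℝ≥0)) : ℝ≥0) : ℂ) * X := by
  have hpos := measureReal_unipotent_level_pos L v μN
  rw [classOrbitalIntegral_eq_mul_integral_of_level_frame L H hH hHd w hw νG hmG ψ hψK hψc μN t hd hreg ha' hb' hγ₀ g hgm hginv F hF, hX,
    ← mul_assoc (_ : ℂ)⁻¹, inv_mul_cancel₀ (Complex.ofReal_ne_zero.2 hpos.ne'), one_mul]

/-! ## §3 The residual-rank instance: a depth-zero piece at a DEEP regular split-torus class -/

section Deep

variable (L : Type) [Field L] [NumberField L] [IsCMField L] {v : HeightOneSpectrum (𝓞 ↥(maximalRealSubfield L))}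
  (w : PlacesOver L v) (hw : IsCMField.complexConj L • w.1 = w.1)

include hw in
/-- **A DEEP TORUS ELEMENT LIES IN `K₃`**: `t = diag(d) ∈ T(L⁺_v)` with `|d_{i,w} − 1|_w < 1` for all `i` (so `|d_{i,w}|_w = |d_{i,w}⁻¹|_w = 1`) has `t ∈ U(Φ₃)(𝒪_v)`
(★ `mem_localIntegralLevel_iff_of_smul_eq`: the `w`-component `t_w = diag(d_w)` and its inverse are integral). [cite: Rogawski1990, §4.9 p. 54] [cite: PlatonovRapinchuk1994, §5.1] -/
theorem torus_three_mem_cmLocalIntegralLevel_of_deep (t : ↥(torusU (conjLocal L (IsCMField.complexConj L) v) (cmLocalForm L 3 v))) {d : Fin 3 → (LocalRing L v)ˣ}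
    (hd : glDiagonal 3 (LocalRing L v) d =
      ((t : ↥(unitaryGroupOfForm (conjLocal L (IsCMField.complexConj L) v) (cmLocalForm L 3 v))) : GL (Fin 3) (LocalRing L v)))
    (ht1 : ∀ i : Fin 3, Valued.v ((((d i : (LocalRing L v)ˣ) : LocalRing L v) w) - 1) < 1) :
    (t : ↥(unitaryGroupOfForm (conjLocal L (IsCMField.complexConj L) v) (cmLocalForm L 3 v))) ∈
      cmLocalIntegralLevel L 3 (Matrix.of fun i j : Fin 3 => if i.val + j.val + 1 = 3 then (1 : L) else 0) v := by
  have hcne := IsCMField.complexConj_ne_one L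
  haveI : Algebra.IsQuadraticExtension ↥(maximalRealSubfield L) L := IsCMField.isQuadraticExtension L
  -- `|d_{i,w}|_w = 1`
  have hdv : ∀ i : Fin 3, Valued.v (((d i : (LocalRing L v)ˣ) : LocalRing L v) w) = 1 := by
    intro i
    have h := Valuation.map_add_eq_of_lt_left (v := (Valued.v : Valuation (w.1.adicCompletion L) _))
      (x := (1 : w.1.adicCompletion L)) (y := (((d i : (LocalRing L v)ˣ) : LocalRing L v) w) - 1) (by rw [Valuation.map_one]; exact ht1 i)
    rwa [add_sub_cancel, Valuation.map_one] at h
  refine (mem_localIntegralLevel_iff_of_smul_eq (IsCMField.complexConj L) 3 _ hcne w hw _).2 ?_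
  -- the `w`-component matrix of `t` is `diagonal (d_w)`
  have hmat : (((localNonsplitEquiv (IsCMField.complexConj L) (Matrix.of fun i j : Fin 3 => if i.val + j.val + 1 = 3 then (1 : L) else 0)
        hcne w hw (t : ↥(unitaryGroupOfForm (conjLocal L (IsCMField.complexConj L) v) (cmLocalForm L 3 v))) :
          ↥(unitaryGroupOfForm (galAdicCompletionMap (L := L) (IsCMField.complexConj L) hw)
            (placeForm (Matrix.of fun i j : Fin 3 => if i.val + j.val + 1 = 3 then (1 : L) else 0) w.1))) :
        GL (Fin 3) (w.1.adicCompletion L)) : Matrix (Fin 3) (Fin 3) (w.1.adicCompletion L)) =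
      Matrix.diagonal fun i => ((d i : (LocalRing L v)ˣ) : LocalRing L v) w := by
    rw [coe_coe_localNonsplitEquiv_apply, ← hd, coe_glDiagonal,
      Matrix.diagonal_map (RingHom.map_zero (Pi.evalRingHom (fun w' : PlacesOver L v => w'.1.adicCompletion L) w))]
    rfl
  refine mem_glInt_of_isIntegralMatrix (fun i j => ?_) ?_
  · rw [hmat, Matrix.diagonal_apply]
    split_ifs
    · exact (v_le_one_iff_mem_integer _).1 (hdv i).le
    · exact Subring.zero_mem _
  · rw [hmat, Matrix.det_diagonal, map_prod]
    exact Finset.prod_eq_one fun i _ => (v_eq_one_iff_valuation_eq_one _).1 (hdv i)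

/-- **THE REDUCTION OF A DEEP TORUS ELEMENT IS `1`**: `red(t_w) = 1` for `t = diag(d)` with `|d_{i,w} − 1|_w < 1`. [cite: Rogawski1990, §4.9 p. 54] [cite: Kottwitz1986, §3] -/
theorem redMat_map_torus_three_eq_one_of_deep (t : ↥(torusU (conjLocal L (IsCMField.complexConj L) v) (cmLocalForm L 3 v))) {d : Fin 3 → (LocalRing L v)ˣ}
    (hd : glDiagonal 3 (LocalRing L v) d =
      ((t : ↥(unitaryGroupOfForm (conjLocal L (IsCMField.complexConj L) v) (cmLocalForm L 3 v))) : GL (Fin 3) (LocalRing L v)))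
    (ht1 : ∀ i : Fin 3, Valued.v ((((d i : (LocalRing L v)ˣ) : LocalRing L v) w) - 1) < 1) :
    redMat ((((t : ↥(unitaryGroupOfForm (conjLocal L (IsCMField.complexConj L) v) (cmLocalForm L 3 v))) : GL (Fin 3) (LocalRing L v)) :
        Matrix (Fin 3) (Fin 3) (LocalRing L v)).map (Pi.evalRingHom (fun w' : PlacesOver L v => w'.1.adicCompletion L) w)) = 1 := by
  -- `red(x) = 1` for `|x − 1|_w < 1`
  have hred : ∀ x : w.1.adicCompletion L, Valued.v (x - 1) < 1 → red x = 1 := by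
    intro x hx
    have hx1 : Valued.v x = 1 := by
      have h := Valuation.map_add_eq_of_lt_left (v := (Valued.v : Valuation (w.1.adicCompletion L) _))
        (x := (1 : w.1.adicCompletion L)) (y := x - 1) (by rw [Valuation.map_one]; exact hx)
      rwa [add_sub_cancel, Valuation.map_one] at h
    have hxO : x ∈ 𝒪[w.1.adicCompletion L] := (v_le_one_iff_mem_integer _).1 hx1.le
    have hsubO : x - 1 ∈ 𝒪[w.1.adicCompletion L] := (v_le_one_iff_mem_integer _).1 hx.le
    rw [show x = ((⟨x, hxO⟩ : 𝒪[w.1.adicCompletion L]) : w.1.adicCompletion L) from rfl, red_coe]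
    have hmax : (⟨x, hxO⟩ : 𝒪[w.1.adicCompletion L]) - 1 ∈ IsLocalRing.maximalIdeal 𝒪[w.1.adicCompletion L] := by
      rw [IsLocalRing.mem_maximalIdeal, mem_nonunits_iff, Valuation.Integers.isUnit_iff_valuation_eq_one (Valuation.integer.integers _)]
      change ¬ ValuativeRel.valuation (w.1.adicCompletion L) (x - 1) = 1
      exact ne_of_lt ((v_lt_one_iff_valuation_lt_one _).1 hx)
    rw [← sub_eq_zero, ← map_one (IsLocalRing.residue 𝒪[w.1.adicCompletion L]), ← map_sub, IsLocalRing.residue_eq_zero_iff]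
    exact hmax
  rw [← hd, coe_glDiagonal, Matrix.diagonal_map (RingHom.map_zero (Pi.evalRingHom (fun w' : PlacesOver L v => w'.1.adicCompletion L) w))]
  ext i j
  rw [redMat, Matrix.map_apply, Matrix.diagonal_apply, Matrix.one_apply]
  split_ifs with h
  · exact hred _ (ht1 i)
  · rw [show (0 : w.1.adicCompletion L) = ((0 : 𝒪[w.1.adicCompletion L]) : w.1.adicCompletion L) from rfl, red_coe, map_zero]

set_option maxHeartbeats 1600000 in
-- instance-term unification on the CM local carriers (as in ★ FILE D)
open scoped Classical in
include hw in
/-- **THE RESIDUAL-RANK INSTANCE OF THE DESCENT HYPOTHESIS.**  For a piece `g` on `U(H)(L⁺_v)` supported in `K′` (`hgK`) with `g k = c(rank(red k_w − 1))` on the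
residually-unipotent part of `K′` (`hc`), a frame `ψ` preserving the level (`hψK`) and reading `(ψ g)_w = T g_w T⁻¹` with `T ∈ GL₃(𝒪_w)` (`hψT`), and a DEEP
`t = diag(d) ∈ T` (`|d_{i,w} − 1|_w < 1`): for every `n ∈ N`,
**`g(ψ⁻¹(t n)) = [n ∈ K₃] · c(rank(red(n_w) − 1))`** — `ψ⁻¹(tn) ∈ K′ ⟺ tn ∈ K₃ ⟺ n ∈ K₃` (`t ∈ K₃`); off `K₃` the support kills `g`; on it
`(ψ⁻¹(tn))_w = T⁻¹ (t_w n_w) T`, `red(t_w n_w) = red(n_w)` (★ L-α1 `redMat_mul_of_redMat_eq_one`), rank and nilpotency of `red(·) − 1` are `GL₃(𝒪_w)`-conjugation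
invariants (★ O8b `rank_redMat_conj_sub_one_eq`, `redMat_conj_sub_one_pow_eq_zero_iff`) and `(red(n_w) − 1)³ = 0` (★ FILE A `redMat_map_heisElt_sub_one_pow_three`).
[cite: Rogawski1990, §4.9 p. 54] [cite: Kottwitz1986, §3] [cite: Flicker1998UnitaryFL, §2] -/
theorem apply_symm_torus_mul_eq_piece_rank (H : Matrix (Fin 3) (Fin 3) L)
    (ψ : (cmDatum L 3 H).Local v ≃ₜ* ↥(unitaryGroupOfForm (conjLocal L (IsCMField.complexConj L) v) (cmLocalForm L 3 v)))
    (hψK : ∀ g : (cmDatum L 3 H).Local v, ψ g ∈ cmLocalIntegralLevel L 3 (Matrix.of fun i j : Fin 3 => if i.val + j.val + 1 = 3 then (1 : L) else 0) v ↔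
      g ∈ cmLocalIntegralLevel L 3 H v)
    (T : GL (Fin 3) (w.1.adicCompletion L)) (hT : T ∈ glInt 3 (w.1.adicCompletion L))
    (hψT : ∀ g : (cmDatum L 3 H).Local v, localGLPiEquiv L 3 v
        (((ψ g : ↥(unitaryGroupOfForm (conjLocal L (IsCMField.complexConj L) v) (cmLocalForm L 3 v))) : GL (Fin 3) (LocalRing L v))) w =
      T * localGLPiEquiv L 3 v (g.val : GL (Fin 3) (LocalRing L v)) w * T⁻¹)
    (t : ↥(torusU (conjLocal L (IsCMField.complexConj L) v) (cmLocalForm L 3 v))) {d : Fin 3 → (LocalRing L v)ˣ}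
    (hd : glDiagonal 3 (LocalRing L v) d =
      ((t : ↥(unitaryGroupOfForm (conjLocal L (IsCMField.complexConj L) v) (cmLocalForm L 3 v))) : GL (Fin 3) (LocalRing L v)))
    (ht1 : ∀ i : Fin 3, Valued.v ((((d i : (LocalRing L v)ˣ) : LocalRing L v) w) - 1) < 1)
    (g : (cmDatum L 3 H).Local v → ℂ) (hgK : tsupport g ⊆ (cmLocalIntegralLevel L 3 H v : Set ((cmDatum L 3 H).Local v)))
    (c : ℕ → ℂ)
    (hc : ∀ k ∈ cmLocalIntegralLevel L 3 H v,
      (redMat (((k.val : GL (Fin 3) (UnitaryGroup.LocalRing L v)).val.map (Pi.evalRingHom (fun w' : PlacesOver L v => w'.1.adicCompletion L) w))) - 1) ^ 3 = 0 →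
      g k = c (redMat (((k.val : GL (Fin 3) (UnitaryGroup.LocalRing L v)).val.map (Pi.evalRingHom (fun w' : PlacesOver L v => w'.1.adicCompletion L) w))) - 1).rank)
    (n : ↥(unipotentU (conjLocal L (IsCMField.complexConj L) v) (cmLocalForm L 3 v))) :
    g (ψ.symm ((t : ↥(unitaryGroupOfForm (conjLocal L (IsCMField.complexConj L) v) (cmLocalForm L 3 v))) *
        (n : ↥(unitaryGroupOfForm (conjLocal L (IsCMField.complexConj L) v) (cmLocalForm L 3 v))))) =
      if (n : ↥(unitaryGroupOfForm (conjLocal L (IsCMField.complexConj L) v) (cmLocalForm L 3 v))) ∈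
          cmLocalIntegralLevel L 3 (Matrix.of fun i j : Fin 3 => if i.val + j.val + 1 = 3 then (1 : L) else 0) v then
        c (redMat (((n : ↥(unitaryGroupOfForm (conjLocal L (IsCMField.complexConj L) v) (cmLocalForm L 3 v))) : GL (Fin 3) (LocalRing L v)).val.map
          (Pi.evalRingHom (fun w' : PlacesOver L v => w'.1.adicCompletion L) w)) - 1).rank
      else 0 := by
  have hcne := IsCMField.complexConj_ne_one L
  haveI : Algebra.IsQuadraticExtension ↥(maximalRealSubfield L) L := IsCMField.isQuadraticExtension L
  letI : Invertible (2 : LocalRing L v) := (isUnit_two_localRing L v).invertible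
  -- the point `k = ψ⁻¹(t n)` and its level
  set k : (cmDatum L 3 H).Local v := ψ.symm ((t : ↥(unitaryGroupOfForm (conjLocal L (IsCMField.complexConj L) v) (cmLocalForm L 3 v))) *
    (n : ↥(unitaryGroupOfForm (conjLocal L (IsCMField.complexConj L) v) (cmLocalForm L 3 v)))) with hk
  have hψk : ψ k = (t : ↥(unitaryGroupOfForm (conjLocal L (IsCMField.complexConj L) v) (cmLocalForm L 3 v))) *
      (n : ↥(unitaryGroupOfForm (conjLocal L (IsCMField.complexConj L) v) (cmLocalForm L 3 v))) := ψ.apply_symm_apply _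
  have htK := torus_three_mem_cmLocalIntegralLevel_of_deep L w hw t hd ht1
  have hmem : k ∈ cmLocalIntegralLevel L 3 H v ↔ (n : ↥(unitaryGroupOfForm (conjLocal L (IsCMField.complexConj L) v) (cmLocalForm L 3 v))) ∈
      cmLocalIntegralLevel L 3 (Matrix.of fun i j : Fin 3 => if i.val + j.val + 1 = 3 then (1 : L) else 0) v := by
    rw [← hψK k, hψk]
    exact Subgroup.mul_mem_cancel_left _ htK
  by_cases hn : (n : ↥(unitaryGroupOfForm (conjLocal L (IsCMField.complexConj L) v) (cmLocalForm L 3 v))) ∈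
      cmLocalIntegralLevel L 3 (Matrix.of fun i j : Fin 3 => if i.val + j.val + 1 = 3 then (1 : L) else 0) v
  · rw [if_pos hn]
    have hkK : k ∈ cmLocalIntegralLevel L 3 H v := hmem.2 hn
    -- `w`-components: `X = (ψ k)_w = (t n)_w ∈ GL₃(𝒪_w)` and `k_w = T⁻¹ X T`
    obtain ⟨X, hX⟩ : ∃ X : GL (Fin 3) (w.1.adicCompletion L), X = localGLPiEquiv L 3 v
        (((ψ k : ↥(unitaryGroupOfForm (conjLocal L (IsCMField.complexConj L) v) (cmLocalForm L 3 v))) : GL (Fin 3) (LocalRing L v))) w := ⟨_, rfl⟩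
    have hXint : X ∈ glInt 3 (w.1.adicCompletion L) := by
      rw [hX]
      exact (mem_localIntegralLevel_iff_of_smul_eq (IsCMField.complexConj L) 3 _ hcne w hw _).1 ((hψK k).2 hkK)
    have hkw : localGLPiEquiv L 3 v (k.val : GL (Fin 3) (LocalRing L v)) w = T⁻¹ * X * T := by
      have h := hψT k
      rw [← hX] at h
      rw [h]; group
    -- matrices of the `w`-components
    have hkmat : ((k.val : GL (Fin 3) (UnitaryGroup.LocalRing L v)).val.map (Pi.evalRingHom (fun w' : PlacesOver L v => w'.1.adicCompletion L) w)) =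
        ((T⁻¹ * X * T : GL (Fin 3) (w.1.adicCompletion L)) : Matrix (Fin 3) (Fin 3) (w.1.adicCompletion L)) := by
      rw [← hkw, GLn.coe_piEquiv_apply]
    have hXmat : (X : Matrix (Fin 3) (Fin 3) (w.1.adicCompletion L)) =
        ((((t : ↥(unitaryGroupOfForm (conjLocal L (IsCMField.complexConj L) v) (cmLocalForm L 3 v))) : GL (Fin 3) (LocalRing L v)) :
            Matrix (Fin 3) (Fin 3) (LocalRing L v)).map (Pi.evalRingHom (fun w' : PlacesOver L v => w'.1.adicCompletion L) w)) *
          (((n : ↥(unitaryGroupOfForm (conjLocal L (IsCMField.complexConj L) v) (cmLocalForm L 3 v))) : GL (Fin 3) (LocalRing L v)).val.map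
            (Pi.evalRingHom (fun w' : PlacesOver L v => w'.1.adicCompletion L) w)) := by
      rw [hX, hψk, GLn.coe_piEquiv_apply, Subgroup.coe_mul, Units.val_mul, Matrix.map_mul]
    -- integrality of `t_w`, `n_w`
    have htint : localGLPiEquiv L 3 v (((t : ↥(unitaryGroupOfForm (conjLocal L (IsCMField.complexConj L) v) (cmLocalForm L 3 v))) : GL (Fin 3) (LocalRing L v))) w ∈
        glInt 3 (w.1.adicCompletion L) :=
      (mem_localIntegralLevel_iff_of_smul_eq (IsCMField.complexConj L) 3 _ hcne w hw _).1 htK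
    have hnint : localGLPiEquiv L 3 v (((n : ↥(unitaryGroupOfForm (conjLocal L (IsCMField.complexConj L) v) (cmLocalForm L 3 v))) : GL (Fin 3) (LocalRing L v))) w ∈
        glInt 3 (w.1.adicCompletion L) :=
      (mem_localIntegralLevel_iff_of_smul_eq (IsCMField.complexConj L) 3 _ hcne w hw _).1 hn
    have hvb : ∀ {Y : GL (Fin 3) (LocalRing L v)}, localGLPiEquiv L 3 v Y w ∈ glInt 3 (w.1.adicCompletion L) →
        ValBound 1 ((Y : Matrix (Fin 3) (Fin 3) (LocalRing L v)).map (Pi.evalRingHom (fun w' : PlacesOver L v => w'.1.adicCompletion L) w)) := by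
      intro Y hY i j
      have h := ((mem_glInt_iff _).1 hY).1 i j
      rw [GLn.coe_piEquiv_apply] at h
      exact (Valuation.mem_integer_iff _ _).1 h
    have hXred : redMat (X : Matrix (Fin 3) (Fin 3) (w.1.adicCompletion L)) =
        redMat ((((n : ↥(unitaryGroupOfForm (conjLocal L (IsCMField.complexConj L) v) (cmLocalForm L 3 v))) : GL (Fin 3) (LocalRing L v)).val.map
          (Pi.evalRingHom (fun w' : PlacesOver L v => w'.1.adicCompletion L) w))) := by
      rw [hXmat]
      exact redMat_mul_of_redMat_eq_one (hvb htint) (hvb hnint) (redMat_map_torus_three_eq_one_of_deep L w t hd ht1)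
    -- nilpotency of `red(n_w) − 1` (★ FILE A through the chart `n = u(x, z)`)
    have hn3 : (redMat ((((n : ↥(unitaryGroupOfForm (conjLocal L (IsCMField.complexConj L) v) (cmLocalForm L 3 v))) : GL (Fin 3) (LocalRing L v)).val.map
          (Pi.evalRingHom (fun w' : PlacesOver L v => w'.1.adicCompletion L) w))) - 1) ^ 3 = 0 := by
      rw [← HeisRing.heisElt_heisX_heisY (conjLocal L (IsCMField.complexConj L) v) (conjLocal_conjLocal_cm L v) (cmLocalForm_eq_over L 3 v) n]
      exact redMat_map_heisElt_sub_one_pow_three L v w hw _ _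
    have hk3 : (redMat (((k.val : GL (Fin 3) (UnitaryGroup.LocalRing L v)).val.map (Pi.evalRingHom (fun w' : PlacesOver L v => w'.1.adicCompletion L) w))) - 1) ^ 3 = 0 := by
      rw [hkmat, redMat_conj_sub_one_pow_eq_zero_iff hT hXint 3, hXred]
      exact hn3
    rw [hc k hkK hk3, hkmat, rank_redMat_conj_sub_one_eq hT hXint, hXred]
  · rw [if_neg hn]
    have hkK : k ∉ cmLocalIntegralLevel L 3 H v := fun h => hn (hmem.1 h)
    exact image_eq_zero_of_notMem_tsupport fun h => hkK (hgK h)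

set_option maxHeartbeats 1600000 in
-- instance-term unification on the CM local carriers (as in ★ FILE D)
include hw in
/-- **THE CANONICAL ORBITAL INTEGRAL OF A DEPTH-ZERO PIECE AT A DEEP REGULAR SPLIT-TORUS CLASS OF THE INNER FORM** ((O2) of `stub_T3prime_levi`).  `v` non-split,
UNRAMIFIED in `L`, `v ∤ 2`; `ψ` the level-preserving Jacobowitz frame with its `T ∈ GL₃(𝒪_w)` (★ `exists_continuousMulEquiv_level_formCongr_of_nonsplit`); `m_G` canonical;
`t = diag(d) ∈ T` REGULAR and DEEP, `ψ γ₀ = t`; `g ∈ C_c^∞(U(H)(L⁺_v))` supported in `K′`, `Ad K′`-invariant, `= c r` on the residually-unipotent Jordan stratum `r` of `K′`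
(HEAD v4's `hg hgK hginv hc` VERBATIM).  Then
**`classOrbitalIntegral m_G g ⟦γ₀⟧ = ν_G(K′) · J₃(t) · q⁻³ · (c₀·1 + c₁·(q − 1) + c₂·(q³ − q))`**, `q = N𝔭_v`
(§2 socket ∘ `apply_symm_torus_mul_eq_piece_rank` ∘ ★ FILE C `integral_eq_of_eq_piece_rank`). [cite: Rogawski1990, §4.9 Prop. 4.9.1 pp. 54–56; §4.3 (4.3.1) p. 43]
[cite: Flicker1998UnitaryFL, §2] [cite: Kottwitz1986, §3] -/
theorem classOrbitalIntegral_eq_mul_rankStrata_of_torus_deep (H : Matrix (Fin 3) (Fin 3) L)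
    (hH : (H.map (IsCMField.complexConj L))ᵀ = H) (hHd : IsUnit H.det)
    (hv : Algebra.IsUnramifiedIn (𝓞 L) v.asIdeal) (h2 : IsUnit (2 : 𝒪[w.1.adicCompletion L]))
    [MeasurableSpace ((cmDatum L 3 H).Local v)] [BorelSpace ((cmDatum L 3 H).Local v)]
    [∀ γ : (cmDatum L 3 H).Local v, MeasurableSpace (((cmDatum L 3 H).Local v) ⧸ Subgroup.centralizer ({γ} : Set ((cmDatum L 3 H).Local v)))]
    [∀ γ : (cmDatum L 3 H).Local v, BorelSpace (((cmDatum L 3 H).Local v) ⧸ Subgroup.centralizer ({γ} : Set ((cmDatum L 3 H).Local v)))]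
    (νG : Measure ((cmDatum L 3 H).Local v)) [νG.IsHaarMeasure] [νG.IsMulRightInvariant]
    {mG : OrbitalMeasureFamily ((cmDatum L 3 H).Local v)}
    (hmG : mG.IsCanonical (fun γ => IsRegularElt (γ.val : GL (Fin 3) (LocalRing L v))) νG)
    [MeasurableSpace ↥(unitaryGroupOfForm (conjLocal L (IsCMField.complexConj L) v) (cmLocalForm L 3 v))]
    [BorelSpace ↥(unitaryGroupOfForm (conjLocal L (IsCMField.complexConj L) v) (cmLocalForm L 3 v))]
    (ψ : (cmDatum L 3 H).Local v ≃ₜ* ↥(unitaryGroupOfForm (conjLocal L (IsCMField.complexConj L) v) (cmLocalForm L 3 v)))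
    (hψK : ∀ g : (cmDatum L 3 H).Local v, ψ g ∈ cmLocalIntegralLevel L 3 (Matrix.of fun i j : Fin 3 => if i.val + j.val + 1 = 3 then (1 : L) else 0) v ↔
      g ∈ cmLocalIntegralLevel L 3 H v)
    (hψc : ∀ g : (cmDatum L 3 H).Local v, IsConj (g.val : GL (Fin 3) (LocalRing L v))
      ((ψ g : ↥(unitaryGroupOfForm (conjLocal L (IsCMField.complexConj L) v) (cmLocalForm L 3 v))) : GL (Fin 3) (LocalRing L v)))
    (T : GL (Fin 3) (w.1.adicCompletion L)) (hT : T ∈ glInt 3 (w.1.adicCompletion L))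
    (hψT : ∀ g : (cmDatum L 3 H).Local v, localGLPiEquiv L 3 v
        (((ψ g : ↥(unitaryGroupOfForm (conjLocal L (IsCMField.complexConj L) v) (cmLocalForm L 3 v))) : GL (Fin 3) (LocalRing L v))) w =
      T * localGLPiEquiv L 3 v (g.val : GL (Fin 3) (LocalRing L v)) w * T⁻¹)
    (t : ↥(torusU (conjLocal L (IsCMField.complexConj L) v) (cmLocalForm L 3 v))) {d : Fin 3 → (LocalRing L v)ˣ}
    (hd : glDiagonal 3 (LocalRing L v) d =
      ((t : ↥(unitaryGroupOfForm (conjLocal L (IsCMField.complexConj L) v) (cmLocalForm L 3 v))) : GL (Fin 3) (LocalRing L v)))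
    (hreg : ∀ i j, i ≠ j → IsUnit ((d i : LocalRing L v) - d j))
    (ha' : IsUnit ((((d 0)⁻¹ * d 1 : (LocalRing L v)ˣ) : LocalRing L v) - 1))
    (hb' : IsUnit ((((d 0)⁻¹ * d 2 : (LocalRing L v)ˣ) : LocalRing L v) - 1))
    (ht1 : ∀ i : Fin 3, Valued.v ((((d i : (LocalRing L v)ˣ) : LocalRing L v) w) - 1) < 1)
    {γ₀ : (cmDatum L 3 H).Local v} (hγ₀ : ψ γ₀ = (t : ↥(unitaryGroupOfForm (conjLocal L (IsCMField.complexConj L) v) (cmLocalForm L 3 v))))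
    -- the depth-zero piece: HEAD v4's binders VERBATIM
    (g : ((cmDatum L 3 H).Local v) → ℂ) (hg : Literature.NumberTheory.Rogawski1990.IsLocSmooth g) (hgK : tsupport g ⊆ (cmLocalIntegralLevel L 3 H v : Set ((cmDatum L 3 H).Local v)))
    (hginv : ∀ u ∈ cmLocalIntegralLevel L 3 H v, ∀ x, g (u * x * u⁻¹) = g x)
    (c : ℕ → ℂ)
    (hc : ∀ k ∈ cmLocalIntegralLevel L 3 H v,
      (redMat (((k.val : GL (Fin 3) (UnitaryGroup.LocalRing L v)).val.map (Pi.evalRingHom (fun w' : PlacesOver L v => w'.1.adicCompletion L) w))) - 1) ^ 3 = 0 →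
      g k = c (redMat (((k.val : GL (Fin 3) (UnitaryGroup.LocalRing L v)).val.map (Pi.evalRingHom (fun w' : PlacesOver L v => w'.1.adicCompletion L) w))) - 1).rank) :
    classOrbitalIntegral mG g (ConjClasses.mk γ₀) =
      (νG.real (cmLocalIntegralLevel L 3 H v : Set ((cmDatum L 3 H).Local v)) : ℂ) *
        (((letI : MeasurableSpace (LocalRing L v) := borel _; haveI : BorelSpace (LocalRing L v) := ⟨rfl⟩
          haveI : SecondCountableTopology (LocalRing L v) := secondCountableTopology_localRing (E := L) v
          ((distribHaarChar (LocalRing L v) ha'.unit)⁻¹ *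
            (HeisRing.skewModulus (conjLocal L (IsCMField.complexConj L) v) (continuous_conjLocal L (IsCMField.complexConj L) v) hb'.unit
              (HeisRing.map_unit_torusCentralScalar_sub_one (conjLocal L (IsCMField.complexConj L) v) (cmLocalForm_eq_over L 3 v) t hd hb'))⁻¹ :
                ℝ≥0)) : ℝ≥0) : ℂ) *
        ((((Ideal.absNorm v.asIdeal : ℂ)) ^ 3)⁻¹ *
          (c 0 * 1 + c 1 * ((Ideal.absNorm v.asIdeal : ℂ) - 1) + c 2 * ((Ideal.absNorm v.asIdeal : ℂ) ^ 3 - (Ideal.absNorm v.asIdeal : ℂ)))) := by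
  -- a Haar measure on `N` (it cancels) and `|2|_w = 1`
  haveI : LocallyCompactSpace ↥(unitaryGroupOfForm (conjLocal L (IsCMField.complexConj L) v) (cmLocalForm L 3 v)) :=
    locallyCompactSpace_local (IsCMField.complexConj L) 3 _ v
  haveI : LocallyCompactSpace ↥(unipotentU (conjLocal L (IsCMField.complexConj L) v) (cmLocalForm L 3 v)) :=
    (isClosed_cmBorelTriple_N L v).isClosedEmbedding_subtypeVal.locallyCompactSpace
  obtain ⟨μN, hμN⟩ : ∃ μN : Measure ↥(unipotentU (conjLocal L (IsCMField.complexConj L) v) (cmLocalForm L 3 v)), μN.IsHaarMeasure :=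
    ⟨Measure.haar, inferInstance⟩
  haveI := hμN
  have h2w : Valued.v (2 : w.1.adicCompletion L) = 1 := by
    rw [Valuation.Integers.isUnit_iff_valuation_eq_one (Valuation.integer.integers (ValuativeRel.valuation (w.1.adicCompletion L))),
      (ValuativeRel.isEquiv (ValuativeRel.valuation (w.1.adicCompletion L)) (Valued.v : Valuation (w.1.adicCompletion L) _)).eq_one_iff_eq_one] at h2
    exact h2
  -- ★ FILE C on the rank instance `F(n) = g(ψ⁻¹(t n))`
  have hInt := integral_eq_of_eq_piece_rank L v w hw μN hv h2w c
    (fun n => g (ψ.symm ((t : ↥(unitaryGroupOfForm (conjLocal L (IsCMField.complexConj L) v) (cmLocalForm L 3 v))) *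
      (n : ↥(unitaryGroupOfForm (conjLocal L (IsCMField.complexConj L) v) (cmLocalForm L 3 v))))))
    (fun n => apply_symm_torus_mul_eq_piece_rank L w hw H ψ hψK T hT hψT t hd ht1 g hgK c hc n)
  exact classOrbitalIntegral_eq_mul_of_level_frame_of_integral_eq L H hH hHd w hw νG hmG ψ hψK hψc μN t hd hreg ha' hb' hγ₀ g
    hg.continuous.measurable hginv _ (fun _ => rfl) _ hInt

end Deep

end Literature.NumberTheory.Automorphic.UnitaryGroup

end
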